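import Summits.Ventures.GridStability.Lyapunov.WSCC9LosslessPolytopeRoa
import Summits.Ventures.GridStability.Lyapunov.StructurePreservingPolytopeCusa
import HarnessLib

/-!
# GridStability/Lyapunov/WSCC9LosslessPolytopeCusa — «WSCC9-postB-L-SPdamp» on Vu–Turitsyn's
# polytope at the SHARP rational level `c = 33/100` (Cusa–Huygens bound; the closed-form level is
# `0.3316`)

Cell `gridfusion` (LADDER-GRIDFUSION), seat gridfusion-lyap-1 (g6). Sequel of
`Lyapunov/WSCC9LosslessPolytopeRoa.lean` (p538862: the same object and sentence at `c = 27/100` with the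
`sin`-substitution bound of p531996) using `StructurePreservingPolytopeCusa.vtGap_ge_cusa_d6`
(`vtGap d ≥ 2 cos d − (3.141593 − 6|sin d|/(2 + cos d))·|sin d|`, `|d| ≤ π/2`): on the binding pair
machines 0–1 (`θ* = −39.95°`, `C = 0.806`) the rational bound rises from `0.2745` to `0.3306` against the
float closed form `C·vtGap = 0.3316`, so the certified level becomes `33/100` (99.5 % of the closed
form). OBJECT BY NAME and LABEL as in the parent file: g4's `WSCC9LffNU.data.toModel` — «synthetic
lossless VARIANT of the printed 9-bus with the printed NON-UNIFORM damping `D_i/M_i = 1/10, 1/5, 3/10`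
— a PIPELINE sentence, not a 9-bus sentence» (MV-2L synthetic + MV-RD + MV-SPD + MV-h12)
[cite: SauerPai1998, §7.9.3 Ex. 7.1].

THREE COLUMNS. CERTIFIED (kernel, here): `pairChecksC` (ONE `decide` over `ℚ`, 6 ordered pairs:
`33/100 < C_ij·(2cd_ij − (3.141593 − 6|sd_ij|/(2 + cd_ij))·|sd_ij|)`), `level_lt_pairGap_cusa`
(`33/100 < C_ij·vtGap(θ*_i − θ*_j)`), `polytope_synchronisation_cusa` (the parent sentence at `33/100`).
MODELLED: the label. VALIDATED: nothing. No SDP; no sentence of this file says that the WSCC system or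
any grid is stable. No definition; no named fact; standard axioms.
-/

noncomputable section

open Set Filter Topology Real Finset
open Summit.Ventures.GridStability.Models
open Summit.Ventures.GridStability.Models.StructurePreserving
open Summit.Ventures.GridStability.Lyapunov.StructurePreserving (vtGap_ge_cusa_d6)
open Summit.Ventures.GridStability.Lyapunov.ClassicalSwingPolytope
open Summit.Ventures.GridStability.Lyapunov.WSCC9LffNU (data data_eqData data_Cc_pos)
open Summit.Ventures.GridStability.Lyapunov.WSCC9LosslessPolytope
open Literature.MathematicalPhysics.PowerSystems.ClassicalModel.LosslessSystem (vtGap)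

namespace Summit.Ventures.GridStability.Lyapunov.WSCC9LosslessPolytope

/-- **Per-pair level checks with the Cusa–Huygens bound (one `decide` over `ℚ`)**: for every ordered
pair of distinct machines, `33/100 < C_ij·(2·cd_ij − (3.141593 − 6|sd_ij|/(2 + cd_ij))·|sd_ij|)`
(binding pair machines 0–1, bound `0.3306`). CERTIFIED column. [cite: VuTuritsyn2016, Appendix 9.3] -/
theorem pairChecksC : ∀ i j : Fin 3, i ≠ j →
    (33 / 100 : ℚ) < data.Cc i j
      * (2 * data.cd i j
        - (3141593 / 1000000 - 6 * |data.sd i j| / (2 + data.cd i j)) * |data.sd i j|) := by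
  decide +kernel

/-- **The certified per-pair level, sharp form**: `33/100 < C_ij·vtGap(θ*_i − θ*_j)` for `i ≠ j`.
CERTIFIED column. [cite: VuTuritsyn2016, §IV (third construction) and Appendix 9.3] -/
theorem level_lt_pairGap_cusa {i j : Fin 3} (hij : i ≠ j) (_hC : data.toModel.Ccoef i j ≠ 0) :
    (33 / 100 : ℝ) < data.toModel.Ccoef i j * vtGap (data.angleOf i - data.angleOf j) := by
  have hq := (Rat.cast_lt (K := ℝ)).2 (pairChecksC i j hij)
  push_cast at hq
  have hcd : (data.cd i j : ℝ) = Real.cos (data.angleOf i - data.angleOf j) := data.cd_cast data_eqData i j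
  have hsd : (data.sd i j : ℝ) = Real.sin (data.angleOf i - data.angleOf j) := data.sd_cast data_eqData i j
  rw [hcd, hsd] at hq
  have hgap := vtGap_ge_cusa_d6 (d := data.angleOf i - data.angleOf j) (abs_angle_lt hij).le
  rw [Ccoef_eq]
  have hC : (0 : ℝ) ≤ (data.Cc i j : ℝ) := by exact_mod_cast (data_Cc_pos i j hij).le
  calc (33 / 100 : ℝ) < (data.Cc i j : ℝ) * (2 * Real.cos (data.angleOf i - data.angleOf j)
        - (3141593 / 1000000 - 6 * |Real.sin (data.angleOf i - data.angleOf j)|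
            / (2 + Real.cos (data.angleOf i - data.angleOf j)))
          * |Real.sin (data.angleOf i - data.angleOf j)|) := hq
    _ ≤ (data.Cc i j : ℝ) * vtGap (data.angleOf i - data.angleOf j) :=
        mul_le_mul_of_nonneg_left (by norm_num at hgap ⊢; exact hgap) hC

/-- **«WSCC9-postB-L-SPdamp» on Vu–Turitsyn's polytope at the sharp level `33/100`.** The sentence
of `WSCC9LosslessPolytope.polytope_synchronisation` (model-1's `data.toModel`, 3 machines, PRINTED
non-uniform damping, lossless post-B couplings; every solution on `univ` from the polytope on the
momentum leaf) with `V ≤ 33/100` in place of `27/100`: the polytope and `V ≤ 33/100` hold for all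
`t ≥ 0` and `(δ, ω) → (θ*, 0)`. LABEL: synthetic lossless variant, PIPELINE sentence, not a 9-bus
sentence; no sentence here says a grid is stable.
[cite: VuTuritsyn2016, §IV; SauerPai1998, §7.9.3 eqs. (7.215)–(7.216)] -/
theorem polytope_synchronisation_cusa {γ : ℝ → ClassicalSwing.State 3}
    (hγ : data.toModel.IsSolutionOn γ univ)
    (hpol : ∀ i j, i ≠ j → data.toModel.Ccoef i j ≠ 0 →
      |((γ 0).1 i - (γ 0).1 j) + (data.angleOf i - data.angleOf j)| < π)
    (hL : ∑ i, data.toModel.M i * (γ 0).2 i + ∑ i, data.toModel.D i * (γ 0).1 i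
      = ∑ i, data.toModel.D i * data.angleOf i)
    (hV : (spParams data.toModel).energy data.angleOf (γ 0).1 (γ 0).2 ≤ 33 / 100) :
    (∀ t, 0 ≤ t →
        (∀ i j, i ≠ j → data.toModel.Ccoef i j ≠ 0 →
          |((γ t).1 i - (γ t).1 j) + (data.angleOf i - data.angleOf j)| < π) ∧
        (spParams data.toModel).energy data.angleOf (γ t).1 (γ t).2 ≤ 33 / 100) ∧
      Tendsto γ atTop (𝓝 (data.angleOf, 0)) :=
  ClassicalSwingPolytope.polytope_synchronisation data.toModel (by decide) M_pos D_pos B_symm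
    isLossless (fun _ _ hij => (Ccoef_pos hij).le) preconnected isEquilibrium
    (fun _ _ hij _ => abs_angle_lt hij) (fun _ _ hij hC => level_lt_pairGap_cusa hij hC) hγ hpol hL hV

end Summit.Ventures.GridStability.Lyapunov.WSCC9LosslessPolytope

end
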